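import Summits.BirchSwinnertonDyer.BirchSwinnertonDyer.Theorems.OneSidedTwistSqueezeX9KatoDivisibilityX9StubKolyvaginPrimePkX9
import Summits.BirchSwinnertonDyer.BirchSwinnertonDyer.Theorems.OneSidedTwistSqueezeX9KatoDivisibilityX9SahPk
import Summits.BirchSwinnertonDyer.BirchSwinnertonDyer.Theorems.OneSidedTwistSqueezeX9KatoDivisibilityX9GradedCoreAlgebra
import Summits.BirchSwinnertonDyer.BirchSwinnertonDyer.Theorems.OneSidedTwistSqueezeX9KatoDivisibilityX9SahRelPk
import HarnessLib

set_option autoImplicit false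

-- the summit and its single problem are both named `BirchSwinnertonDyer` (registry layout D-0017)
set_option linter.dupNamespace false

/-!
# Stub 1b' `stub_kolyvaginPrimePkDefectX9` of line `graded_euler_loss` (skeleton v4; crux `KatoDivisibilityX9` =
# stmt-BirchSwinnertonDyer-20547): TEST PAIR OF DEFECT `δ` ↦ KOLYVAGIN PRIME at `p`-level `d+1`

Seat `bsd-line-k6-p4` (prover-bsd-line-k6-p4-g5-0, 5th LEAD).  THEOREMS ONLY, sorry-free, no definition, no named fact;
`--supports stmt-BirchSwinnertonDyer-20547` (registered stub `stub_kolyvaginPrimePkDefectX9` of skeleton v4, sha16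
e565e6f84b4fa2f5, = hypothesis `h12` of the landed bounded-defect assembly
`…GradedCoreAssemblyDefect.fineCoreGraded_of_supply_of_testCocycle_of_kolyvaginPrime_of_reciprocity`, p627676).
The v3 form (`δ = 0`, full `T`-order of the test class) is the landed `…StubKolyvaginPrimePkX9.stub_kolyvaginPrimePkX9`
(p626585); v4 needs the test class only up to a DEFECT `δ` (`T^{e−1−δ}ψ ≠ 0`), because the bounded-defect test pairs of
the repaired Selmer side give truncations of defect `δ₀`.

THE ARGUMENT, sharper than v3's (no index counting): let `H' = N_e(κ) ⊓ N_e(κ⁻¹) ⊓ ker ρ_{E,p^{d+1}}` and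
`N = ker ρ_{E,p^{d+1}} ⊓ ker κ ≤ H'`.
* §1 (sibling helper file `…KatoDivisibilityX9SahRelPk.lean`) SAH RELATIVE TO `N` for `E[p]`- and `𝒯_J(E)`-valued cocycles: the level-`p^k` central scalar `σ₁ ∈ ker κ`
  (`…CentralScalarPk`, `σ₁ = c` on `E[p^k]`, `p ∤ c − 1`) is central modulo `N` (`…SahPk.exists_mem_inf_mul_eq_of_zsmul_eq_pk`),
  acts as `c` on `E[p]` and on every `𝒯_J(E, κ^{±1})`, and `c − 1` is invertible there; relative Sah (`SahRel`) ⟹ a cocycle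
  vanishing on `N` is a coboundary.
* Hence `φ(H') = 𝒯_e` (ALL of it: `LevelE.valueSubgroup_eq_top_of_towerConst_ne_zero` with the Sah input on `H' ⊇ N`), and
  `ψ(H') = T^{c}𝒯_e` (`LevelE.modPTwist_stable_addSubgroup_eq_tPow`) with `c ≤ δ` (§2: if `c ≥ δ + 1` the truncation of `ψ` to
  level `δ + 1` vanishes on `N`, so its class is `0`, so `T^{e−1−δ}[ψ] = T·-embedding of it = 0`).
* Polarisation with `x`-slots `(0,1)` and `y`-slots `(c, c+1)` (p614716) and read-off (`…DefectLevels`): `C_c` or `C_{c+1} ≠ 0`,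
  `j ≤ δ + 1 = c₀ + 1` with `c₀ := δ`; Chebotarev half p624294; `N₁ := max n₁ (δ + 2)`.

HONEST LABEL: closes the registered stub 1b' of the DEPTH obligation; stubs 1s / 1a' / 1c' / width / F1_ζ and the crux stay
OPEN; PARTITION untouched; beyond-print theorem toward BSD: NO; no summit statement is proved by this seat; BSD is not proved
by any of this.

References: C.-H. Sah, J. Algebra 10 (1968) Prop. 2.7 (b) [Sah1968]; J.-P. Serre, Invent. Math. 15 (1972) §2.4 Prop. 15, §2.6
[Serre1972]; B. Mazur, K. Rubin, Mem. AMS 799 (2004) §4.4, §5.3 [MazurRubin2004]; J. Tate in Cassels–Fröhlich VII §2.4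
[TateGCFT1967]; HOME/MEMO-es.md §15, §25.7.
-/

noncomputable section

open scoped Classical NumberField ContRepresentation
open WeierstrassCurve Field IsDedekindDomain Function
open Literature.NumberTheory.GaloisRepresentations
open Literature.NumberTheory.GaloisCohomology
open Literature.NumberTheory.EllipticCurves
open Summit.BirchSwinnertonDyer.BirchSwinnertonDyer.Rank1Residual
open Summit.BirchSwinnertonDyer.BirchSwinnertonDyer.Theorems.OneSidedTwistSqueezeX9KatoDivisibilityX9ChebotarevPk
open Summit.BirchSwinnertonDyer.BirchSwinnertonDyer.Theorems.OneSidedTwistSqueezeX9KatoDivisibilityX9DefectLevels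
open Summit.BirchSwinnertonDyer.BirchSwinnertonDyer.Theorems.OneSidedTwistSqueezeX9KatoDivisibilityX9CentralScalarPk
open Summit.BirchSwinnertonDyer.BirchSwinnertonDyer.Theorems.OneSidedTwistSqueezeX9KatoDivisibilityX9SahPk
open Summit.BirchSwinnertonDyer.BirchSwinnertonDyer.Theorems.OneSidedTwistSqueezeX9KatoDivisibilityX9GradedCoreAlgebra

open Summit.BirchSwinnertonDyer.BirchSwinnertonDyer.Theorems.OneSidedTwistSqueezeX9KatoDivisibilityX9SahRelPk

namespace Summit.BirchSwinnertonDyer.BirchSwinnertonDyer.Theorems.OneSidedTwistSqueezeX9KatoDivisibilityX9StubKolyvaginPrimePkDefectX9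

/-! ## §1 STEP 1 WITH DEFECT `δ` on `H' = N_e(κ) ⊓ N_e(κ⁻¹) ⊓ ker ρ_{E,p^k}` (no index counting) -/

section Defect

/-- **Lemma 5.7.B with defect `δ`, at `p`-level `k ≥ 1`.**  `p` odd, `E[p]` irreducible, `ρ̄_{E,p}` not onto; `κ' ∈ 𝐇¹_Ω`
with `κ̄' ≠ 0`, `φ` a cocycle of `κ'_e`, `ψ` a cocycle of the dual twist with `T^{e−1−δ}[ψ] ≠ 0`, `e = e' + 1 ≥ δ + 2`,
`e_W` a Weil pairing.  Then some joint value `z = (φ τ, ψ τ)`, `τ ∈ H' = N_e(κ) ⊓ N_e(κ⁻¹) ⊓ ker ρ_{E,p^k}`, has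
`C_j(z₁, z₂) ≠ 0` for some `j ≤ δ + 1` (`j = c` or `c + 1`, `c ≤ δ` the defect level of `ψ(H') = T^c𝒯_e`; `φ(H') = 𝒯_e`).
[cite: MazurRubin2004, §4.4 and §5.3] [cite: Serre1972, §2.4 Prop. 15 and §2.6] [cite: Sah1968, Prop. 2.7 (b)] -/
theorem exists_jointValue_convCoeff_ne_zero_of_defect (W : WeierstrassCurve ℚ) [W.IsElliptic]
    (p : ℕ) [Fact p.Prime] (κ : ZpExtension ℚ p) {γ : absoluteGaloisGroup ℚ}
    (hp2 : p ≠ 2) (hirr : W.HasIrreducibleModPGaloisRep p) (hns : ¬ W.HasSurjectiveModNGaloisRep p)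
    (hγ : κ.IsTopGenerator γ) {k : ℕ} (hk : 1 ≤ k) (δ : ℕ)
    (κ' : κ.twistTower (W.torsionGaloisModule (p : ℤ))
      (fun P : geomTorsion W (p : ℤ) => AddSubgroup.torsionBy.nsmul P))
    (hκ'c : κ.towerConst (W.torsionGaloisModule (p : ℤ)) (fun P => AddSubgroup.torsionBy.nsmul P) κ' ≠ 0)
    {e' : ℕ} (he : δ + 2 ≤ e' + 1)
    (φ : contOneCocycles (W.modPTwist p κ (e' + 1)).toTopRep)
    (hφ : oneCocycleClass (W.modPTwist p κ (e' + 1)).toTopRep φ = κ'.1 (e' + 1))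
    (ψ : contOneCocycles (W.modPTwist p κ.invTwist (e' + 1)).toTopRep)
    (hψT : (κ.invTwist.shiftH1 (W.torsionGaloisModule (p : ℤ))
      (fun P : geomTorsion W (p : ℤ) => AddSubgroup.torsionBy.nsmul P) (e' + 1))^[e' - δ]
        (oneCocycleClass (W.modPTwist p κ.invTwist (e' + 1)).toTopRep ψ) ≠ 0)
    (eW : geomTorsion W (p : ℤ) → geomTorsion W (p : ℤ) → AlgebraicClosure ℚ)
    (hμ : ∀ S T, eW S T ^ p = 1) (hadd₁ : ∀ S₁ S₂ T, eW (S₁ + S₂) T = eW S₁ T * eW S₂ T)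
    (hadd₂ : ∀ S T₁ T₂, eW S (T₁ + T₂) = eW S T₁ * eW S T₂) (hnondeg : ∀ T, (∀ S, eW S T = 1) → T = 0) :
    ∃ z ∈ contOneCocycles.jointValueSubgroup φ ψ
      (((κ.twistModPRepresentation (W.torsionGaloisModule (p : ℤ))
          (fun P : geomTorsion W (p : ℤ) => AddSubgroup.torsionBy.nsmul P) (e' + 1)).ker ⊓
        (κ.invTwist.twistModPRepresentation (W.torsionGaloisModule (p : ℤ))
          (fun P : geomTorsion W (p : ℤ) => AddSubgroup.torsionBy.nsmul P) (e' + 1)).ker) ⊓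
        (galoisRepTorsion W ((p : ℤ) ^ k)).ker)
      (fun _ hτ x => κ.toTopRep_ρ_apply_eq_self_of_mem_ker (W.torsionGaloisModule (p : ℤ)) _ (e' + 1)
        (Subgroup.mem_inf.mp (Subgroup.mem_inf.mp hτ).1).1 x)
      (fun _ hτ y => κ.invTwist.toTopRep_ρ_apply_eq_self_of_mem_ker (W.torsionGaloisModule (p : ℤ)) _
        (e' + 1) (Subgroup.mem_inf.mp (Subgroup.mem_inf.mp hτ).1).2 y),
      ∃ j : ℕ, j ≤ δ + 1 ∧ j < e' + 1 ∧
        convCoeff (weilPairingHom W p eW hμ hadd₁ hadd₂) (e' + 1) j z.1 z.2 ≠ 0 := by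
  have hp : p.Prime := Fact.out
  haveI : Finite (geomTorsion W (p : ℤ)) :=
    finite_torsionPoints_holds W (AlgebraicClosure ℚ) (by exact_mod_cast hp.ne_zero)
  haveI : NeZero p := ⟨hp.ne_zero⟩
  have he1 : 1 < e' + 1 := by omega
  -- the subgroups `K = ker ρ_{E,p^k}`, `H = N_e(κ) ⊓ N_e(κ⁻¹)`, `H' = H ⊓ K ⊇ N = K ⊓ ker κ`
  set K : Subgroup (absoluteGaloisGroup ℚ) := (galoisRepTorsion W ((p : ℤ) ^ k)).ker with hKdef
  set H : Subgroup (absoluteGaloisGroup ℚ) :=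
    (κ.twistModPRepresentation (W.torsionGaloisModule (p : ℤ))
        (fun P : geomTorsion W (p : ℤ) => AddSubgroup.torsionBy.nsmul P) (e' + 1)).ker ⊓
      (κ.invTwist.twistModPRepresentation (W.torsionGaloisModule (p : ℤ))
        (fun P : geomTorsion W (p : ℤ) => AddSubgroup.torsionBy.nsmul P) (e' + 1)).ker
    with hHdef
  have hX' : ∀ τ ∈ H ⊓ K, ∀ x : (W.modPTwist p κ (e' + 1)).toTopRep,
      (W.modPTwist p κ (e' + 1)).toTopRep.ρ τ x = x := fun τ hτ x =>
    κ.toTopRep_ρ_apply_eq_self_of_mem_ker (W.torsionGaloisModule (p : ℤ)) _ (e' + 1)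
      (Subgroup.mem_inf.mp (Subgroup.mem_inf.mp hτ).1).1 x
  have hY' : ∀ τ ∈ H ⊓ K, ∀ y : (W.modPTwist p κ.invTwist (e' + 1)).toTopRep,
      (W.modPTwist p κ.invTwist (e' + 1)).toTopRep.ρ τ y = y := fun τ hτ y =>
    κ.invTwist.toTopRep_ρ_apply_eq_self_of_mem_ker (W.torsionGaloisModule (p : ℤ)) _ (e' + 1)
      (Subgroup.mem_inf.mp (Subgroup.mem_inf.mp hτ).1).2 y
  haveI hHn : (H ⊓ K).Normal := by rw [hHdef, hKdef]; infer_instance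
  have hNH : K ⊓ κ.kerSubgroup ≤ H ⊓ K := by
    refine le_inf (le_inf ?_ ?_) inf_le_left
    · rw [hKdef]; exact ker_inf_kerSubgroup_le_ker_twistModPRepresentation W p κ hk (e' + 1)
    · rw [hKdef, ← ZpExtension.kerSubgroup_unitTwist κ (-1)]
      exact ker_inf_kerSubgroup_le_ker_twistModPRepresentation W p κ.invTwist hk (e' + 1)
  -- Sah relative to `N` for `E[p]`: the `φ`-side value group on `H'` is everything
  have hSahE : ∀ ψ' : contOneCocycles (W.torsionGaloisModule (p : ℤ)).toTopRep,
      oneCocycleClass (W.torsionGaloisModule (p : ℤ)).toTopRep ψ' ≠ 0 → ∃ τ ∈ H ⊓ K, ψ'.1 τ ≠ 0 := by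
    intro ψ' hψ'
    by_contra hcon
    push Not at hcon
    exact hψ' (torsion_oneCocycleClass_eq_zero_of_forall_mem_pk_eq_zero W p κ hp2 hirr hns hk ψ'
      fun ν hν => hcon ν (hNH (by rwa [hKdef])))
  have hφtop : contOneCocycles.valueSubgroup φ (H ⊓ K) hX' = ⊤ :=
    LevelE.valueSubgroup_eq_top_of_towerConst_ne_zero W p κ hirr hns hγ κ' hκ'c e' φ hφ (H ⊓ K) hX' hSahE
  -- a topological generator `γ₀` fixing `E[p]`; `ψ(H') = T^{c}𝒯_e` with `c ≤ δ`
  obtain ⟨γ₀, hγ₀, hγ₀E⟩ :=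
    exists_isTopGenerator_forall_smul_eq_of_irreducible_of_not_surjective W p κ hirr hns
  have hγ₀' : κ.invTwist.IsTopGenerator γ₀⁻¹ := LevelE.isTopGenerator_invTwist_inv κ hγ₀
  have hγ₀E' : ∀ P : geomTorsion W (p : ℤ), γ₀⁻¹ • P = P := fun P => by
    rw [inv_smul_eq_iff, hγ₀E]
  obtain ⟨c, hce, hP₂⟩ := LevelE.modPTwist_stable_addSubgroup_eq_tPow W p κ.invTwist (e' + 1) hirr hγ₀'
    hγ₀E' (contOneCocycles.valueSubgroup ψ (H ⊓ K) hY')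
    (fun σ _ hy => contOneCocycles.smul_mem_valueSubgroup ψ (H ⊓ K) hY' σ hy)
  have hcδ : c ≤ δ :=
    defectLevel_le_of_shiftH1_iterate_ne_zero W p κ hp2 hirr hns hk ψ hψT (H ⊓ K) hY'
      (by rwa [hKdef] at hNH) hP₂
  have hclt : c + 1 < e' + 1 := by omega
  -- the joint value module `M'` and its `ZMod p`-linear repackaging
  classical
  letI : Module (ZMod p) (geomTorsion W (p : ℤ)) := AddSubgroup.torsionBy.zmodModule
  set Mj := contOneCocycles.jointValueSubgroup φ ψ (H ⊓ K) hX' hY' with hMjdef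
  let Mk : Submodule (ZMod p)
      ((Fin (e' + 1) → geomTorsion W (p : ℤ)) × (Fin (e' + 1) → geomTorsion W (p : ℤ))) :=
    AddSubgroup.toZModSubmodule p Mj
  have hMkmem : ∀ z, z ∈ Mk ↔ z ∈ Mj := fun z => AddSubgroup.mem_toZModSubmodule p
  -- the operators `γ₀ − 1` on the two twists: `T = S`, `D = −S·U`
  let T : (Fin (e' + 1) → geomTorsion W (p : ℤ)) →ₗ[ZMod p] (Fin (e' + 1) → geomTorsion W (p : ℤ)) :=
    ((W.modPTwist p κ (e' + 1) γ₀).toAddMonoidHom - AddMonoidHom.id _).toZModLinearMap p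
  let D : (Fin (e' + 1) → geomTorsion W (p : ℤ)) →ₗ[ZMod p] (Fin (e' + 1) → geomTorsion W (p : ℤ)) :=
    ((W.modPTwist p κ.invTwist (e' + 1) γ₀).toAddMonoidHom - AddMonoidHom.id _).toZModLinearMap p
  have hfix : ∀ x : Fin (e' + 1) → geomTorsion W (p : ℤ),
      (fun i => W.torsionGaloisModule (p : ℤ) γ₀ (x i)) = x := fun x =>
    funext fun i => by rw [WeierstrassCurve.torsionGaloisModule_apply_apply, hγ₀E]
  have hTapply : ∀ x, T x =
      W.modPTwist p κ (e' + 1) γ₀ x - fun i => W.torsionGaloisModule (p : ℤ) γ₀ (x i) :=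
    fun x => by rw [hfix]; rfl
  have hDapply : ∀ y, D y =
      W.modPTwist p κ.invTwist (e' + 1) γ₀ y - fun i => W.torsionGaloisModule (p : ℤ) γ₀ (y i) :=
    fun y => by rw [hfix]; rfl
  have hTS : ∀ x, T x = shiftEnd (geomTorsion W (p : ℤ)) (e' + 1) x := fun x => by
    rw [hTapply]
    refine (ZpExtension.twistModP_apply_sub_of_isTopGenerator κ _ _ (e' + 1) hγ₀ x).trans ?_
    rw [hfix]
  have hDS : ∀ y, D y = -(shiftEnd (geomTorsion W (p : ℤ)) (e' + 1)
      (unipotentPow (geomTorsion W (p : ℤ)) (e' + 1) (κ.invTwist.twistExponent (e' + 1) γ₀) y)) :=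
    fun y => by
    rw [hDapply]
    refine (LevelE.invTwist_twistModP_apply_sub_of_isTopGenerator κ _ _ (e' + 1) hγ₀ y).trans ?_
    rw [hfix]
  have hMkT : ∀ z ∈ Mk, (T z.1, D z.2) ∈ Mk := by
    intro z hz
    rw [hMkmem] at hz ⊢
    exact LevelE.sub_mem_of_prod_stable (W.modPTwist p κ (e' + 1) γ₀).toAddMonoidHom
      (W.modPTwist p κ.invTwist (e' + 1) γ₀).toAddMonoidHom Mj (fun w hw =>
        contOneCocycles.smul_mem_jointValueSubgroup φ ψ (H ⊓ K) hX' hY' γ₀ hw) hz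
  -- coordinates: the second component of a joint value vanishes below the defect level `c`
  have hMc2 : ∀ z ∈ Mk, ∀ i : Fin (e' + 1), (i : ℕ) < c → z.2 i = 0 := fun z hz =>
    (hP₂ z.2).mp (by
      obtain ⟨τ, hτ, hz'⟩ := (hMkmem z).mp hz
      exact ⟨τ, hτ, congrArg Prod.snd hz'⟩)
  have hT0 : ∀ z ∈ Mk, T z.1 ⟨0, by omega⟩ = 0 := fun z _ => by
    rw [hTS, shiftEnd_apply, dif_pos rfl]
  have hT1 : ∀ z ∈ Mk, T z.1 ⟨1, he1⟩ = z.1 ⟨0, by omega⟩ := fun z _ => by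
    rw [hTS, shiftEnd_apply, dif_neg (by simp)]
    congr 1
  have hD0 : ∀ z ∈ Mk, D z.2 ⟨c, by omega⟩ = 0 := fun z hz => by
    rw [hDS, Pi.neg_apply, neg_eq_zero, shiftEnd_apply]
    by_cases h0 : c = 0
    · rw [dif_pos (by simpa using h0)]
    · rw [dif_neg (by simpa using h0),
        unipotentPow_apply_of_forall_lt _ _ (hMc2 z hz) _ (by simp only; omega)]
      exact hMc2 z hz _ (by simp only; omega)
  have hD1 : ∀ z ∈ Mk, D z.2 ⟨c + 1, hclt⟩ = -z.2 ⟨c, by omega⟩ := fun z hz => by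
    rw [hDS, Pi.neg_apply, shiftEnd_apply, dif_neg (by simp),
      unipotentPow_apply_of_forall_lt _ _ (hMc2 z hz) _ (by simp)]
    congr 2
  -- slot `0` of the first projection and slot `c` of the second projection are everything
  have h1M : ∀ v : geomTorsion W (p : ℤ), ∃ z ∈ Mk, z.1 ⟨0, by omega⟩ = v := fun v => by
    obtain ⟨z, hz, hz1⟩ := contOneCocycles.exists_mem_jointValueSubgroup_fst_eq φ ψ (H ⊓ K) hX' hY' hφtop
      (fun i => if (i : ℕ) = 0 then v else 0)
    exact ⟨z, (hMkmem z).mpr hz, by rw [hz1]; simp⟩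
  have h2M : ∀ v : geomTorsion W (p : ℤ), ∃ z ∈ Mk, z.2 ⟨c, by omega⟩ = v := fun v => by
    have hv : (Pi.single (⟨c, by omega⟩ : Fin (e' + 1)) v : Fin (e' + 1) → geomTorsion W (p : ℤ)) ∈
        contOneCocycles.valueSubgroup ψ (H ⊓ K) hY' := by
      rw [hP₂]
      intro i hi
      rw [Pi.single_apply, if_neg]
      rintro rfl
      simp at hi
    obtain ⟨z, hz, hz2⟩ := (contOneCocycles.snd_jointValueSubgroup φ ψ (H ⊓ K) hX' hY' _).mp hv
    exact ⟨z, (hMkmem z).mpr hz, by rw [hz2]; simp⟩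
  -- the Weil pairing as a `ZMod p`-valued bilinear form (`μ_p ≃ ℤ/p`), not identically zero
  set eWH := weilPairingHom W p eW hμ hadd₁ hadd₂ with heWH
  set ι := muCarrierZModEquiv ℚ p with hι
  set evAdd : geomTorsion W (p : ℤ) →+ geomTorsion W (p : ℤ) →+ ZMod p :=
    eWH.flip.compr₂ ι.toAddMonoidHom with hevAdd
  let ev : geomTorsion W (p : ℤ) →ₗ[ZMod p] geomTorsion W (p : ℤ) →ₗ[ZMod p] ZMod p :=
    LinearMap.mk₂ (ZMod p) (fun y v => evAdd y v)
      (fun y₁ y₂ v => by rw [evAdd.map_add]; rfl)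
      (fun c y v => ZMod.map_smul (evAdd.flip v) c y)
      (fun y v₁ v₂ => (evAdd y).map_add v₁ v₂)
      (fun c y v => ZMod.map_smul (evAdd y) c v)
  have hev_apply : ∀ y v, ev y v = ι (eWH v y) := fun _ _ => rfl
  haveI : Nontrivial (geomTorsion W (p : ℤ)) := by
    have hcard : 1 < Nat.card (geomTorsion W (p : ℤ)) := by
      rw [W.natCard_geomTorsion (n := (p : ℤ)) (by exact_mod_cast hp.ne_zero), Int.natAbs_natCast]
      nlinarith [hp.one_lt]
    exact Finite.one_lt_card_iff_nontrivial.mp hcard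
  have hev : ∃ y v, ev y v ≠ 0 := by
    obtain ⟨T₀, hT₀⟩ := exists_ne (0 : geomTorsion W (p : ℤ))
    have hS : ∃ S, eW S T₀ ≠ 1 := by
      by_contra h
      push Not at h
      exact hT₀ (hnondeg T₀ h)
    obtain ⟨S, hS⟩ := hS
    refine ⟨T₀, S, ?_⟩
    rw [hev_apply]
    intro h0
    apply hS
    have h1 : eWH S T₀ = 0 := ι.map_eq_zero_iff.mp h0
    rw [heWH, muCarrier_eq_iff, coe_weilPairingHom] at h1
    exact h1
  have h2k : (2 : ZMod p) ≠ 0 := by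
    have h : ((2 : ℕ) : ZMod p) ≠ 0 := by
      rw [Ne, ZMod.natCast_eq_zero_iff]
      intro hdvd
      have := Nat.le_of_dvd two_pos hdvd
      have := hp.two_le
      omega
    exact_mod_cast h
  -- POLARISATION with `x`-slots `(0, 1)` and `y`-slots `(c, c+1)`
  obtain ⟨z, hzM, hz01⟩ := LevelE.exists_mem_coeff_ne_zero_of_polarisation₂ h2k
    (⟨0, by omega⟩ : Fin (e' + 1)) ⟨1, he1⟩ (⟨c, by omega⟩ : Fin (e' + 1)) ⟨c + 1, hclt⟩
    ev hev Mk (fun z hz => ⟨(T z.1, D z.2), hMkT z hz, hT0 z hz, hT1 z hz, hD0 z hz, hD1 z hz⟩) h1M h2M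
  -- READ-OFF of `C_c` / `C_{c+1}`
  refine ⟨z, (hMkmem z).mp hzM, ?_⟩
  have hx0 : ∀ i : Fin (e' + 1), (i : ℕ) < 0 → z.1 i = 0 := fun i hi => absurd hi (Nat.not_lt_zero _)
  have hy0 := hMc2 z hzM
  rw [hev_apply, hev_apply, hev_apply, ← map_add] at hz01
  rcases hz01 with h0 | h1
  · refine ⟨0 + c, by omega, by omega, ?_⟩
    rw [convCoeff_add_eq_of_forall_lt eWH (by omega) z.1 z.2 hx0 hy0]
    exact fun h => h0 (by rw [h, map_zero])
  · refine ⟨0 + c + 1, by omega, by omega, ?_⟩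
    rw [convCoeff_add_succ_eq_of_forall_lt eWH (by omega) z.1 z.2 hx0 hy0]
    exact fun h => h1 (by rw [add_comm, h, map_zero])

end Defect

/-! ## §2 The registered stub `stub_kolyvaginPrimePkDefectX9` (hypothesis `h12` of the bounded-defect assembly) -/

section Stub

/-- **STUB 1b' of line `graded_euler_loss` (skeleton v4) — TEST PAIR OF DEFECT `δ` ↦ KOLYVAGIN PRIME at `p`-level `d+1`**
(verbatim the registered signature = hypothesis `h12` of
`…GradedCoreAssemblyDefect.fineCoreGraded_of_supply_of_testCocycle_of_kolyvaginPrime_of_reciprocity`).  Constants: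
`c₀ := δ`, `N₁ := max n₁ (δ + 2)` with `n₁` the Chebotarev threshold of
`…ChebotarevPk.exists_threshold_isArithFrobAt_mem_apply_eq_and_depth_pk_of_ne_two` (`k = d + 1`).  For `N ≥ N₁`, `e = p^N`:
§1 gives a joint value `w` on `H' = N_e(κ) ⊓ N_e(κ⁻¹) ⊓ ker ρ_{E,p^{d+1}}` with `C_j(w) ≠ 0`, `j ≤ δ + 1`, `j < e`; the
Chebotarev half realises `w = (φ Fr, ψ Fr)` by an arithmetic Frobenius `Fr ∈ H'` at a prime `q ∉ S` with
`ρ_{E,p^{d+1}}(Fr) = 1`, `Fr ∈ Gal(ℚ̄/ℚ_N) ∖ Gal(ℚ̄/ℚ_{N+1})`.  (The good-ordinary and cyclotomic binders are not used.)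
[cite: Serre1972, §2.4 Prop. 15 and §2.6] [cite: TateGCFT1967, §2.4 (Tchebotarev density theorem)]
[cite: MazurRubin2004, §4.4 and §5.3] -/
theorem stub_kolyvaginPrimePkDefectX9 : ∀ (W : WeierstrassCurve ℚ) [W.IsElliptic] [W.IsGloballyMinimal] (p : ℕ) [Fact p.Prime]
      (κ : ZpExtension ℚ p) (γ : absoluteGaloisGroup ℚ) (d δ : ℕ),
      p ≠ 2 → W.HasGoodReductionAtPrime p → ¬ ((p : ℤ) ∣ W.frobeniusTrace p) →
      W.HasIrreducibleModPGaloisRep p → ¬ W.HasSurjectiveModNGaloisRep p →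
      κ.IsCyclotomic → κ.IsTopGenerator γ →
      ∃ c₀ N₁ : ℕ, ∀ (N : ℕ), N₁ ≤ N → ∀ (e' : ℕ), e' + 1 = p ^ N →
        ∀ (κ' : κ.twistTower (W.torsionGaloisModule (p : ℤ))
            (fun P : geomTorsion W (p : ℤ) => AddSubgroup.torsionBy.nsmul P)),
          κ.towerConst (W.torsionGaloisModule (p : ℤ)) (fun P => AddSubgroup.torsionBy.nsmul P) κ' ≠ 0 →
        ∀ (φ : contOneCocycles (W.modPTwist p κ (e' + 1)).toTopRep),
          oneCocycleClass (W.modPTwist p κ (e' + 1)).toTopRep φ = κ'.1 (e' + 1) →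
        ∀ (ψ : contOneCocycles (W.modPTwist p κ.invTwist (e' + 1)).toTopRep),
          (κ.invTwist.shiftH1 (W.torsionGaloisModule (p : ℤ))
            (fun P : geomTorsion W (p : ℤ) => AddSubgroup.torsionBy.nsmul P) (e' + 1))^[e' - δ]
              (oneCocycleClass (W.modPTwist p κ.invTwist (e' + 1)).toTopRep ψ) ≠ 0 →
        ∀ (eW : geomTorsion W (p : ℤ) → geomTorsion W (p : ℤ) → AlgebraicClosure ℚ)
          (hμ : ∀ S T, eW S T ^ p = 1) (hadd₁ : ∀ S₁ S₂ T, eW (S₁ + S₂) T = eW S₁ T * eW S₂ T)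
          (hadd₂ : ∀ S T₁ T₂, eW S (T₁ + T₂) = eW S T₁ * eW S T₂),
          (∀ T, (∀ S, eW S T = 1) → T = 0) →
        ∀ (S : Set (HeightOneSpectrum (𝓞 ℚ))), S.Finite →
        ∃ q : HeightOneSpectrum (𝓞 ℚ), q ∉ S ∧ ∃ 𝔓 ∈ q.primesAbove, ∃ Fr : absoluteGaloisGroup ℚ,
          IsArithFrobAt (𝓞 ℚ) Fr 𝔓 ∧ galoisRepTorsion W ((p : ℤ) ^ (d + 1)) Fr = 1 ∧
          Fr ∈ κ.layerSubgroup N ∧ Fr ∉ κ.layerSubgroup (N + 1) ∧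
          ∃ j : ℕ, j ≤ c₀ + 1 ∧ j < e' + 1 ∧
            convCoeff (weilPairingHom W p eW hμ hadd₁ hadd₂) (e' + 1) j (φ.1 Fr) (ψ.1 Fr) ≠ 0 := by
  intro W _ _ p _ κ γ d δ hp2 _ _ hirr hns _ hγ
  have hp : p.Prime := Fact.out
  obtain ⟨n₁, hn₁⟩ := exists_threshold_isArithFrobAt_mem_apply_eq_and_depth_pk_of_ne_two W p κ hp2 hirr hns
    (k := d + 1) (by omega)
  refine ⟨δ, max n₁ (δ + 2), ?_⟩
  intro N hN e' he κ' hκ'c φ hφ ψ hψT eW hμ hadd₁ hadd₂ hnondeg S hS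
  have hNn : n₁ ≤ N := le_of_max_le_left hN
  have hNe : δ + 2 ≤ e' + 1 := by
    have h1 := le_of_max_le_right hN
    have h2 : N < p ^ N := Nat.lt_pow_self hp.one_lt
    omega
  obtain ⟨w, hw, j, hj, hje, hC⟩ := exists_jointValue_convCoeff_ne_zero_of_defect W p κ hp2 hirr hns hγ
    (k := d + 1) (by omega) δ κ' hκ'c hNe φ hφ ψ hψT eW hμ hadd₁ hadd₂ hnondeg
  obtain ⟨_, -, -, -, -, -, -, q, hqS, -, 𝔓, h𝔓, Fr, hFr, -, hφFr, hψFr, hρ, hFrN, hFrN1⟩ :=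
    hn₁ N hNn (J := e' + 1) (J' := e' + 1) (by omega) (by omega) (by omega) φ ψ hw S hS
  exact ⟨q, hqS, 𝔓, h𝔓, Fr, hFr, hρ, hFrN, hFrN1, j, by omega, hje, by rw [hφFr, hψFr]; exact hC⟩

end Stub


end Summit.BirchSwinnertonDyer.BirchSwinnertonDyer.Theorems.OneSidedTwistSqueezeX9KatoDivisibilityX9StubKolyvaginPrimePkDefectX9

end
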